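import Summits.HodgeConjecture.HodgeConjecture.Theorems.HeckePrymWeilWeilTenfoldsSqrtMinus11NormAnchorEigen
import Literature.AlgebraicGeometry.HodgeTheory.WeilClassesSixfoldsProofs
import Literature.AlgebraicGeometry.HodgeTheory.AlgebraicClassesCupAbelianVariety
import Literature.AlgebraicGeometry.HodgeTheory.LefschetzOneOne
import HarnessLib

/-!
# Crux `WeilTenfoldsSqrtMinus11` (stmt-HodgeConjecture-1262, route `HeckePrymWeil`), line
# `quaternionic-norm-anchors`: THE ANCHOR THEOREM (part 2) — on a norm anchor the `ℚ(√-11)`-Weil plane is algebraic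

Topic: `Summit.HodgeConjecture.HodgeConjecture.Theorems.HeckePrymWeil` (namespace `…HeckePrymWeil.NormAnchor`).
Lead `prover-line-stmt-HodgeConjecture-1262-c1-0`, 2026-08-16. Sorry-free, standard axioms; no definition
is introduced (local notation only). CONDITIONAL on the tree's named fact `lefschetzOneOne_rational`
(Lefschetz's theorem on `(1,1)`-classes), taken as an explicit hypothesis.

## Statement (`weilClassesOf_le_algebraicClasses_of_normAnchor`)

Let `A` be a complex abelian TENFOLD and `ψ : A ⟶ A` with `ψ¹¹ = 𝟙` and `Σ_{k<11} ψᵏ = 0` in `End A`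
(an action of `ℤ[(Complex.exp (2 * (Real.pi : ℂ) * Complex.I / 11))]` without invariants on `H¹`), let `φ = g(ψ) = Σ_{k=1}^{10} (k|11) ψᵏ` be the
quadratic Gauss sum (then `φ ≫ φ = -11`, `comp_self_of_isGaussSumOf`), and assume the typed `L`-signature
condition `SignatureOneOne` of the line's skeleton: for every 11th root of unity `u ≠ 1`, the
`(1+u)²`-eigenspace of `(𝟙+ψ)^*` on `H²(A(ℂ);ℂ)` lies in the `ℂ`-span of the rational `(1,1)`-classes.
These are exactly the clauses of the skeleton's `IsNormAnchor A ψ φ θ` (`Lines/quaternionic-norm-anchors.lean`)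
minus the polarization `θ`, which is not needed. THEN the whole Weil plane of `(A, φ)` for `K = ℚ(√-11)`,
`weilClassesOf A φ 5 11 = E₊ ⊕ E₋ ⊆ H¹⁰(A(ℂ);ℂ)` (`HodgeTheory/WeilClasses`), consists of algebraic
classes: `weilClassesOf A φ 5 11 ≤ algebraicClasses A.X 5`. By the landed typing bridge (stub T,
`Theorems/HeckePrymWeilWeilTenfoldsSqrtMinus11StubWeilPlaneTyping`) this is the crux `WeilTenfoldsSqrtMinus11`
restricted to the norm anchors — the "anchor theorem" which the idea card (`Ideas/quaternionic-norm-anchors.md`,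
First lemma `CyclotomicNormAnchor` / `NormIdentity`) and the line card call KNOWN (`W_K = N_{L/K}(⋀²_L H¹)` is a
norm of divisor classes; Moonen–Zarhin) and which the skeleton bypasses; here it is PROVED on the carriers.

## Proof (van Geemen's wedge eigenbasis, one level deeper: `L = ℚ((Complex.exp (2 * (Real.pi : ℂ) * Complex.I / 11))) ⊃ K`; §1–§4, §5b in part 1 `…NormAnchorEigen`)

* §1 `f ↦ f^*|_{H¹}` is additive, unital and power-preserving `End A → End_ℂ H¹` (the tree's
  `complexBetti_map_add_one`; stated as an existence, `exists_pullOne`), so `(ψ^*)¹¹ = 1`,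
  `Σ_{k<11}(ψ^*)ᵏ = 0` and `φ^* = g(ψ^*)` on `H¹`.
* §2 `ψ^*` is semisimple (killed by the separable `X¹¹ - 1`), its eigenvalues are primitive 11th roots
  `ζ^{j+1}` (`1` is excluded by the norm relation), so `H¹ = ⊕_{j<10} U_j`, `U_j = ker(ψ^* - ζ^{j+1})`
  (`isInternal_U`; Mathlib's `IsSemisimple.iSup_eigenspace_eq_top`, `eigenspaces_iSupIndep`).
* §3 every `U_j` is a PLANE (`finrank_U`): `tr ψ^* = Σ_j ζ^{j+1} dim U_j` is RATIONAL (the tree's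
  `trace_map_one_mem_range_ratCast`), and `1, ζ, …, ζ⁹` are `ℚ`-linearly independent
  (`[ℚ((Complex.exp (2 * (Real.pi : ℂ) * Complex.I / 11))):ℚ] = 10`: `cyclotomic_eq_minpoly_rat`, `linearIndependent_pow`), so the ten multiplicities are
  equal, and they sum to `b₁ = 20` (`abelianVarietyCohomologyExteriorH1_holds`).
* §4 on `U_j` the Gauss sum `φ^*` is the scalar `g(ζ^{j+1})`, and `g(u)² = -11` for a primitive `u`
  (the landed ring identity `Negative.AnchorTyping.gaussSum11_sq`), so `g(ζ^{j+1}) = ± i√11`;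
  `φ ≫ φ = -11` by the same identity in `End A`.
* §5 the set `S₊` of `j` with `g(ζ^{j+1}) = +i√11` has FIVE elements (`card_plusIndices`: `tr φ^*` is
  rational); a product `b ⌣ b'` of two classes of one `U_j` is a `(1+ζ^{j+1})²`-eigenclass of `(𝟙+ψ)^*`
  (`cupProduct_mem_eigenspace_one_add`), hence — signature hypothesis + Lefschetz `(1,1)` — a DIVISOR
  class; iterated products with divisor classes stay algebraic on an abelian variety
  (`cupPowOne_mem_algebraicClasses_of_pairs`, from the tree's `AbelianVariety.cupProduct_mem_algebraicClasses_one`,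
  Voisin II Prop. 9.20 via moving by translations).
* §6 take an eigenbasis of `H¹` adapted to `⊕ U_j` with the five `+`-planes first (`exists_pairIndexEquiv`);
  the cup product `w` of its first ten vectors is non-zero (a wedge-basis vector, `Basis.exteriorPower`
  transported along `H¹⁰ = ⋀¹⁰H¹`), lies in `E₊` (every factor is in `V₊ = ker(φ^* - i√11)`), and is
  algebraic (five pair products); `E₊` is the line through `w` (`weilClassesPlus_le_span_singleton`) and
  `E₋` follows by complex conjugation (`exists_mem_weilClassesMinus_mem_algebraicClasses`).

## References

* [vanGeemen1994HodgeAV] B. van Geemen, An introduction to the Hodge conjecture for abelian varieties,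
  LNM 1594 (1994), 4.8–4.9, proof of Lemma 5.2 and of Thm. 6.12.
* [MoonenZarhin1998WeilClasses] B. Moonen, Yu. Zarhin, Weil classes on abelian varieties, J. reine angew.
  Math. 496 (1998), §2–§5 (Weil classes with respect to a subfield of a field of multiplications).
* [LangeBirkenhake1992] H. Lange, Ch. Birkenhake, Complex Abelian Varieties, §1.1 (Prop. 1.1.9), §13.1.
* [VoisinHodgeII2003] C. Voisin, Hodge Theory and Complex Algebraic Geometry II, §9.2.4 Prop. 9.20.
-/

noncomputable section

set_option linter.dupNamespace false

open CategoryTheory AlgebraicGeometry Complex Polynomial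
open Literature.AlgebraicGeometry.Motives Literature.AlgebraicGeometry.HodgeTheory
open Literature.AlgebraicTopology.SingularHomology
open Summit.HodgeConjecture.HodgeConjecture.Theorems.WeilTenfoldsSqrtMinus11.Negative

namespace Summit.HodgeConjecture.HodgeConjecture.Theorems.HeckePrymWeil

namespace NormAnchor

variable {A : AbelianVariety ℂ}
/-! ### §5 The `+`-Weil line is spanned by a product of five `ψ`-eigen divisor classes -/

section WeilLine

variable {ψ φ : A ⟶ A}

/-- A product `b ⌣ b'` of two classes of `U_u = ker(ψ^* - u)` is a `(1+u)²`-eigenclass of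
`(𝟙 + ψ)^*` on `H²` (`(𝟙+ψ)^* = 1 + ψ^*` on `H¹`, naturality and bilinearity of `⌣`). [folklore] -/
theorem cupProduct_mem_eigenspace_one_add {u : ℂ} {b b' : complexBetti A.X 1}
    (hb : b ∈ Module.End.eigenspace (complexBetti.map ψ.hom.hom.hom 1).hom u) (hb' : b' ∈ Module.End.eigenspace (complexBetti.map ψ.hom.hom.hom 1).hom u) :
    cupProduct (show 1 + 1 = 2 from rfl) b b' ∈
      Module.End.eigenspace (complexBetti.map (𝟙 A + ψ).hom.hom.hom 2).hom ((1 + u) ^ 2) := by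
  rw [Module.End.mem_eigenspace_iff] at hb hb' ⊢
  have h1 : ∀ c : complexBetti A.X 1, (complexBetti.map ψ.hom.hom.hom 1).hom c = u • c → complexBetti.map (𝟙 A + ψ).hom.hom.hom 1 c = (1 + u) • c := by
    intro c hc
    rw [complexBetti_map_add_one]
    change complexBetti.map (𝟙 A.X) 1 c + (complexBetti.map ψ.hom.hom.hom 1).hom c = _
    rw [complexBetti.map_id, hc, add_smul, one_smul]
    rfl
  change singularCohomology.map ℂ ℂ (AlgPoints.mapContinuous (L := ℂ) (𝟙 A + ψ).hom.hom.hom) 2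
    (cupProduct _ b b') = _
  rw [cupProduct_map]
  change cupProduct _ (complexBetti.map (𝟙 A + ψ).hom.hom.hom 1 b) (complexBetti.map (𝟙 A + ψ).hom.hom.hom 1 b') = _
  rw [h1 b hb, h1 b' hb', map_smul, map_smul, LinearMap.smul_apply, smul_smul, sq]

/-- **Iterated products of divisor classes are algebraic**: if `v₀, …, v_{2k-1} ∈ H¹` are such
that each consecutive pair product `v_{2a} ⌣ v_{2a+1}` is a divisor class (`∈ N¹H²`), then
`v₀ ⌣ ⋯ ⌣ v_{2k-1} ∈ NᵏH²ᵏ` (associativity, graded commutativity in even degrees, and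
`Nˡ ∪ N¹ ⊆ Nˡ⁺¹` on an abelian variety, `AbelianVariety.cupProduct_mem_algebraicClasses_one`).
[cite: VoisinHodgeII2003, §9.2.4 Prop. 9.20] -/
theorem cupPowOne_mem_algebraicClasses_of_pairs (k : ℕ) (v : Fin (2 * k) → complexBetti A.X 1)
    (hpair : ∀ a : Fin k, cupProduct (show 1 + 1 = 2 from rfl) (v ⟨2 * a, by omega⟩)
      (v ⟨2 * a + 1, by omega⟩) ∈ algebraicClasses A.X 1) :
    cupPowOne ℂ (ComplexPoints A.X) (2 * k) v ∈ algebraicClasses A.X k := by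
  induction k with
  | zero =>
    rw [algebraicClasses_zero]
    exact Submodule.mem_top
  | succ k ih =>
    have hv' := ih (Fin.tail (Fin.tail v)) (fun a => hpair ⟨(a : ℕ) + 1, by omega⟩)
    have h0 := hpair ⟨0, by omega⟩
    change cupPowOne ℂ (ComplexPoints A.X) (2 * k + 1 + 1) v ∈ algebraicClasses A.X (k + 1)
    rw [cupPowOne_succ, cupPowOne_succ, ← cupProduct_assoc (show 1 + 1 = 2 from rfl)
      (Nat.add_comm 1 (2 * k)) (show 2 + 2 * k = 2 * k + 1 + 1 by omega),
      cupProduct_gradedComm_holds ℂ (ComplexPoints A.X) (show 2 + 2 * k = 2 * k + 1 + 1 by omega)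
        (show 2 * k + 2 = 2 * k + 1 + 1 by omega)]
    have hsign : ((-1 : ℂ) ^ (2 * (2 * k))) = 1 := by
      rw [pow_mul, neg_one_sq, one_pow]
    rw [hsign, one_smul]
    exact AbelianVariety.cupProduct_mem_algebraicClasses_one A hv' h0

/-- The trace of an endomorphism acting by a scalar `c` on an invariant subspace `p` is
`c · dim p`. [folklore] -/
theorem trace_restrict_of_forall_eq_smul {f : Module.End ℂ (complexBetti A.X 1)}
    {p : Submodule ℂ (complexBetti A.X 1)} (hp : Set.MapsTo f p p) {c : ℂ}
    (hc : ∀ v ∈ p, f v = c • v) :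
    LinearMap.trace ℂ p (f.restrict hp) = c * Module.finrank ℂ p := by
  haveI := finite_complexBetti_abelianVariety A 1
  have e : f.restrict hp = c • LinearMap.id := by
    refine LinearMap.ext fun v => Subtype.ext ?_
    rw [LinearMap.restrict_apply, LinearMap.smul_apply, LinearMap.id_apply, Submodule.coe_smul]
    exact hc v v.2
  rw [e, map_smul, LinearMap.trace_id, smul_eq_mul]

/-- The set of indices `j < 10` with `g(ζ^{j+1}) = +i√11` has exactly FIVE elements: the trace of
`φ^*` on `H¹ = ⊕ U_j` (all planes) is `2 i√11 (2·#S₊ - 10)` and is rational. [folklore] -/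
theorem card_plusIndices (hA : A.dim = 10) (hφ : ((CategoryTheory.End.of φ) = (CategoryTheory.End.of ψ) + (CategoryTheory.End.of ψ) ^ 3 + (CategoryTheory.End.of ψ) ^ 4 + (CategoryTheory.End.of ψ) ^ 5 + (CategoryTheory.End.of ψ) ^ 9 - (CategoryTheory.End.of ψ) ^ 2 - (CategoryTheory.End.of ψ) ^ 6 - (CategoryTheory.End.of ψ) ^ 7 - (CategoryTheory.End.of ψ) ^ 8 - (CategoryTheory.End.of ψ) ^ 10)) (h11 : (CategoryTheory.End.of ψ) ^ 11 = 1)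
    (hnorm : (Finset.range 11).sum (fun k => (CategoryTheory.End.of ψ) ^ k) = 0) :
    (Finset.univ.filter fun j : Fin 10 =>
      (((Complex.exp (2 * (Real.pi : ℂ) * Complex.I / 11)) ^ ((j : ℕ) + 1)) + ((Complex.exp (2 * (Real.pi : ℂ) * Complex.I / 11)) ^ ((j : ℕ) + 1)) ^ 3 + ((Complex.exp (2 * (Real.pi : ℂ) * Complex.I / 11)) ^ ((j : ℕ) + 1)) ^ 4 + ((Complex.exp (2 * (Real.pi : ℂ) * Complex.I / 11)) ^ ((j : ℕ) + 1)) ^ 5 + ((Complex.exp (2 * (Real.pi : ℂ) * Complex.I / 11)) ^ ((j : ℕ) + 1)) ^ 9 - ((Complex.exp (2 * (Real.pi : ℂ) * Complex.I / 11)) ^ ((j : ℕ) + 1)) ^ 2 - ((Complex.exp (2 * (Real.pi : ℂ) * Complex.I / 11)) ^ ((j : ℕ) + 1)) ^ 6 - ((Complex.exp (2 * (Real.pi : ℂ) * Complex.I / 11)) ^ ((j : ℕ) + 1)) ^ 7 - ((Complex.exp (2 * (Real.pi : ℂ) * Complex.I / 11)) ^ ((j : ℕ) + 1)) ^ 8 -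 ((Complex.exp (2 * (Real.pi : ℂ) * Complex.I / 11)) ^ ((j : ℕ) + 1)) ^ 10) = Complex.I * (Real.sqrt (11 : ℕ) : ℂ)).card = 5 := by
  classical
  haveI := finite_complexBetti_abelianVariety A 1
  set s : ℂ := Complex.I * (Real.sqrt (11 : ℕ) : ℂ) with hs
  set S := Finset.univ.filter fun j : Fin 10 => (((Complex.exp (2 * (Real.pi : ℂ) * Complex.I / 11)) ^ ((j : ℕ) + 1)) + ((Complex.exp (2 * (Real.pi : ℂ) * Complex.I / 11)) ^ ((j : ℕ) + 1)) ^ 3 + ((Complex.exp (2 * (Real.pi : ℂ) * Complex.I / 11)) ^ ((j : ℕ) + 1)) ^ 4 + ((Complex.exp (2 * (Real.pi : ℂ) * Complex.I / 11)) ^ ((j : ℕ) + 1)) ^ 5 + ((Complex.exp (2 * (Real.pi : ℂ) * Complex.I / 11)) ^ ((j : ℕ) + 1)) ^ 9 - ((Complex.exp (2 * (Real.pi : ℂ) * Complex.I / 11)) ^ ((j : ℕ) + 1)) ^ 2 - ((Complex.exp (2 * (Real.pi : ℂ) * Complex.I / 11)) ^ ((j : ℕ) + 1)) ^ 6 - ((Complex.exp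 (2 * (Real.pi : ℂ) * Complex.I / 11)) ^ ((j : ℕ) + 1)) ^ 7 - ((Complex.exp (2 * (Real.pi : ℂ) * Complex.I / 11)) ^ ((j : ℕ) + 1)) ^ 8 - ((Complex.exp (2 * (Real.pi : ℂ) * Complex.I / 11)) ^ ((j : ℕ) + 1)) ^ 10) = s with hS
  have hs0 : s ≠ 0 := I_mul_sqrt_ne_zero (by norm_num)
  have hN := isInternal_U h11 hnorm
  have hmaps : ∀ j, Set.MapsTo ((complexBetti.map φ.hom.hom.hom 1).hom) ((Module.End.eigenspace (complexBetti.map ψ.hom.hom.hom 1).hom ((Complex.exp (2 * (Real.pi : ℂ) * Complex.I / 11)) ^ (((j : Fin 10) : ℕ) + 1)))) ((Module.End.eigenspace (complexBetti.map ψ.hom.hom.hom 1).hom ((Complex.exp (2 * (Real.pi : ℂ) * Complex.I / 11)) ^ (((j : Fin 10) : ℕ) + 1)))) := fun j v hv => by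
    have := pb_apply_of_mem_eigenspace hφ hv
    rw [SetLike.mem_coe] at hv ⊢
    rw [this]
    exact Submodule.smul_mem _ _ hv
  have htr := LinearMap.trace_eq_sum_trace_restrict hN hmaps
  -- `2 g(ζ^{j+1}) = 4s·[j ∈ S] - 2s`
  have hg : ∀ j : Fin 10, 2 * (((Complex.exp (2 * (Real.pi : ℂ) * Complex.I / 11)) ^ ((j : ℕ) + 1)) + ((Complex.exp (2 * (Real.pi : ℂ) * Complex.I / 11)) ^ ((j : ℕ) + 1)) ^ 3 + ((Complex.exp (2 * (Real.pi : ℂ) * Complex.I / 11)) ^ ((j : ℕ) + 1)) ^ 4 + ((Complex.exp (2 * (Real.pi : ℂ) * Complex.I / 11)) ^ ((j : ℕ) + 1)) ^ 5 + ((Complex.exp (2 * (Real.pi : ℂ) * Complex.I / 11)) ^ ((j : ℕ) + 1)) ^ 9 - ((Complex.exp (2 * (Real.pi : ℂ) * Complex.I / 11)) ^ ((j : ℕ) + 1)) ^ 2 - ((Complex.exp (2 * (Real.pi : ℂ) * Complex.I / 11)) ^ ((j : ℕ) + 1)) ^ 6 - ((Complex.exp (2 * (Real.pi : ℂ) * Complex.I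 / 11)) ^ ((j : ℕ) + 1)) ^ 7 - ((Complex.exp (2 * (Real.pi : ℂ) * Complex.I / 11)) ^ ((j : ℕ) + 1)) ^ 8 - ((Complex.exp (2 * (Real.pi : ℂ) * Complex.I / 11)) ^ ((j : ℕ) + 1)) ^ 10) = 4 * s * (if j ∈ S then 1 else 0) - 2 * s := by
    intro j
    rcases gval_eq_or j with h | h
    · have hj : j ∈ S := by rw [hS, Finset.mem_filter]; exact ⟨Finset.mem_univ _, h⟩
      rw [h, if_pos hj]; ring
    · have hj : j ∉ S := by
        rw [hS, Finset.mem_filter, not_and]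
        intro _ h'
        rw [h] at h'
        exact hs0 (by linear_combination -(h') / 2)
      rw [h, if_neg hj]; ring
  have htr' : LinearMap.trace ℂ _ ((complexBetti.map φ.hom.hom.hom 1).hom) = 4 * s * S.card - 10 • (2 * s) := by
    rw [htr]
    have e : ∀ j : Fin 10, LinearMap.trace ℂ _ (((complexBetti.map φ.hom.hom.hom 1).hom).restrict (hmaps j)) =
        4 * s * (if j ∈ S then 1 else 0) - 2 * s := fun j => by
      rw [trace_restrict_of_forall_eq_smul (hmaps j) (fun v hv => pb_apply_of_mem_eigenspace hφ hv),
        finrank_U hA h11 hnorm j, mul_comm, ← hg j]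
      norm_num
    rw [Finset.sum_congr rfl (fun j _ => e j), Finset.sum_sub_distrib, ← Finset.mul_sum,
      Finset.sum_boole, Finset.sum_const, Finset.card_univ, Fintype.card_fin, Finset.filter_univ_mem]
  -- rationality of the trace and imaginary parts
  obtain ⟨q, hq⟩ := trace_map_one_mem_range_ratCast φ
  change (q : ℂ) = LinearMap.trace ℂ _ ((complexBetti.map φ.hom.hom.hom 1).hom) at hq
  rw [htr'] at hq
  have key : ((q : ℚ) : ℂ) = Complex.I * ((Real.sqrt (11 : ℕ) * (4 * (S.card : ℝ) - 20) : ℝ) : ℂ) := by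
    rw [hq, hs]; push_cast; ring
  have him : (0 : ℝ) = Real.sqrt (11 : ℕ) * (4 * (S.card : ℝ) - 20) := by
    have h1 := congrArg Complex.im key
    rwa [Complex.ratCast_im, Complex.I_mul_im, Complex.ofReal_re] at h1
  have hsq : (Real.sqrt (11 : ℕ) : ℝ) ≠ 0 := (Real.sqrt_pos.mpr (by norm_num)).ne'
  have h2 : 4 * (S.card : ℝ) - 20 = 0 := by
    rcases mul_eq_zero.mp him.symm with h | h
    · exact absurd h hsq
    · exact h
  have : (S.card : ℝ) = 5 := by linarith
  exact_mod_cast this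

end WeilLine

/-! ### §6 THE ANCHOR THEOREM -/

section Main

variable {ψ φ : A ⟶ A}

/-- **The anchor theorem.** Let `A` be a complex abelian TENFOLD with an endomorphism `ψ` of order
`11` and vanishing norm (`ψ¹¹ = 𝟙`, `Σ_{k<11} ψᵏ = 0`: an action of `ℤ[(Complex.exp (2 * (Real.pi : ℂ) * Complex.I / 11))]` with no invariants on
`H¹`), of `L`-signature `(1,1)⁵` in the typed sense `SignatureOneOne` (every `(1+u)²`-eigenclass of
`(𝟙+ψ)^*` on `H²`, `u` a primitive 11th root of unity, is a `ℂ`-combination of rational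
`(1,1)`-classes), and let `φ = g(ψ)` be the quadratic Gauss sum (`φ ≫ φ = -11`). Then, GRANTED
Lefschetz's theorem on `(1,1)`-classes (the tree's named fact `lefschetzOneOne_rational`), the whole
`ℚ(√-11)`-Weil plane `weilClassesOf A φ 5 11 = E₊ ⊕ E₋ ⊆ H¹⁰(A(ℂ);ℂ)` consists of ALGEBRAIC
classes: `E₊ = ⋀¹⁰V₊` is the line through `b₁ ⌣ b₁' ⌣ ⋯ ⌣ b₅ ⌣ b₅'`, where `(b_ν, b_ν')` is a
basis of the plane `U_u ⊆ V₊` (`g(u) = +i√11`; five such `u`, by rationality of `tr φ^*`), and each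
`b_ν ⌣ b_ν'` is a `(1+u)²`-eigenclass of `(𝟙+ψ)^*`, hence a divisor class; products of divisor
classes are algebraic on an abelian variety; `E₋` by complex conjugation. This is the crux
`WeilTenfoldsSqrtMinus11` ON THE NORM ANCHORS of line `quaternionic-norm-anchors` (the card's
"anchor theorem": `W_K = N_{L/K}(⋀²_L H¹)` is a norm of divisor classes; Moonen–Zarhin).
[cite: MoonenZarhin1998WeilClasses, §2 (Weil classes w.r.t. a subfield of the CM field)]
[cite: vanGeemen1994HodgeAV, proof of Thm. 6.12] -/
theorem weilClassesOf_le_algebraicClasses_of_normAnchor (hL : lefschetzOneOne_rational)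
    (hA : A.dim = 10) (h11 : (CategoryTheory.End.of ψ) ^ 11 = 1)
    (hnorm : (Finset.range 11).sum (fun k => (CategoryTheory.End.of ψ) ^ k) = 0) (hφ : ((CategoryTheory.End.of φ) = (CategoryTheory.End.of ψ) + (CategoryTheory.End.of ψ) ^ 3 + (CategoryTheory.End.of ψ) ^ 4 + (CategoryTheory.End.of ψ) ^ 5 + (CategoryTheory.End.of ψ) ^ 9 - (CategoryTheory.End.of ψ) ^ 2 - (CategoryTheory.End.of ψ) ^ 6 - (CategoryTheory.End.of ψ) ^ 7 - (CategoryTheory.End.of ψ) ^ 8 - (CategoryTheory.End.of ψ) ^ 10))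
    (hsig : ∀ u : ℂ, u ^ 11 = 1 → u ≠ 1 →
      Module.End.eigenspace (complexBetti.map (𝟙 A + ψ).hom.hom.hom 2).hom ((1 + u) ^ 2) ≤
        Submodule.span ℂ {b : complexBetti A.X 2 | IsRationalClass b ∧ IsOfHodgeType 10 A.X 2 1 1 b}) :
    weilClassesOf A φ 5 11 ≤ algebraicClasses A.X 5 := by
  classical
  haveI := finite_complexBetti_abelianVariety A 1
  -- data
  set s : ℂ := Complex.I * (Real.sqrt (11 : ℕ) : ℂ) with hs
  set S := Finset.univ.filter fun j : Fin 10 => (((Complex.exp (2 * (Real.pi : ℂ) * Complex.I / 11)) ^ ((j : ℕ) + 1)) + ((Complex.exp (2 * (Real.pi : ℂ) * Complex.I / 11)) ^ ((j : ℕ) + 1)) ^ 3 + ((Complex.exp (2 * (Real.pi : ℂ) * Complex.I / 11)) ^ ((j : ℕ) + 1)) ^ 4 + ((Complex.exp (2 * (Real.pi : ℂ) * Complex.I / 11)) ^ ((j : ℕ) + 1)) ^ 5 + ((Complex.exp (2 * (Real.pi : ℂ) * Complex.I / 11)) ^ ((j : ℕ) + 1)) ^ 9 - ((Complex.exp (2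 * (Real.pi : ℂ) * Complex.I / 11)) ^ ((j : ℕ) + 1)) ^ 2 - ((Complex.exp (2 * (Real.pi : ℂ) * Complex.I / 11)) ^ ((j : ℕ) + 1)) ^ 6 - ((Complex.exp (2 * (Real.pi : ℂ) * Complex.I / 11)) ^ ((j : ℕ) + 1)) ^ 7 - ((Complex.exp (2 * (Real.pi : ℂ) * Complex.I / 11)) ^ ((j : ℕ) + 1)) ^ 8 - ((Complex.exp (2 * (Real.pi : ℂ) * Complex.I / 11)) ^ ((j : ℕ) + 1)) ^ 10) = s with hS
  have hS5 : S.card = 5 := card_plusIndices hA hφ h11 hnorm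
  have hN := isInternal_U h11 hnorm
  have hsp : IsSmoothProjective 10 A.X := hA ▸ AbelianVariety.isSmoothProjective_holds (A := A)
  have hΛ : HasExteriorCohomologyH1 ℂ (ComplexPoints A.X) :=
    abelianVarietyCohomologyExteriorH1_holds.hasExteriorCohomologyH1 A
  have hb₁ : Module.finrank ℂ (complexBetti A.X 1) = 2 * (2 * 5) := by
    rw [abelianVarietyCohomologyExteriorH1_holds.finrank_one A, hA]
  have hφφ : φ ≫ φ = -(11 • 𝟙 A) := comp_self_of_isGaussSumOf hφ h11 hnorm
  -- divisor classes: `(1+u)²`-eigenclasses of `(𝟙+ψ)^*` are algebraic (signature + Lefschetz)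
  have hdiv : ∀ j : Fin 10, ∀ b ∈ (Module.End.eigenspace (complexBetti.map ψ.hom.hom.hom 1).hom ((Complex.exp (2 * (Real.pi : ℂ) * Complex.I / 11)) ^ (((j : Fin 10) : ℕ) + 1))), ∀ b' ∈ (Module.End.eigenspace (complexBetti.map ψ.hom.hom.hom 1).hom ((Complex.exp (2 * (Real.pi : ℂ) * Complex.I / 11)) ^ (((j : Fin 10) : ℕ) + 1))),
      cupProduct (show 1 + 1 = 2 from rfl) b b' ∈ algebraicClasses A.X 1 := by
    intro j b hb b' hb'
    have hu11 : ((Complex.exp (2 * (Real.pi : ℂ) * Complex.I / 11)) ^ ((j : ℕ) + 1)) ^ 11 = 1 := by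
      rw [← pow_mul, mul_comm ((j : ℕ) + 1) 11, pow_mul, zeta_isPrimitiveRoot.pow_eq_one, one_pow]
    have hu1 : (Complex.exp (2 * (Real.pi : ℂ) * Complex.I / 11)) ^ ((j : ℕ) + 1) ≠ 1 := by
      intro h
      have := zeta_isPrimitiveRoot.pow_inj (i := (j : ℕ) + 1) (j := 0) (by omega) (by omega)
        (by rw [h, pow_zero])
      omega
    have h1 := hsig _ hu11 hu1 (cupProduct_mem_eigenspace_one_add hb hb')
    refine (Submodule.span_le.mpr ?_) h1
    rintro c ⟨hc1, hc2⟩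
    exact hL hsp c hc1 hc2
  -- an eigenbasis of `H¹` adapted to `H¹ = ⊕_j U_j`, the five `+`-planes first
  let bU : ∀ j : Fin 10, Module.Basis (Fin 2) ℂ ((Module.End.eigenspace (complexBetti.map ψ.hom.hom.hom 1).hom ((Complex.exp (2 * (Real.pi : ℂ) * Complex.I / 11)) ^ (((j : Fin 10) : ℕ) + 1)))) := fun j =>
    Module.finBasisOfFinrankEq ℂ _ (finrank_U hA h11 hnorm j)
  let B : Module.Basis (Σ _j : Fin 10, Fin 2) ℂ (complexBetti A.X 1) := hN.collectedBasis bU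
  obtain ⟨τ, hτS, hτpair⟩ := exists_pairIndexEquiv S hS5
  let B' : Module.Basis (Fin (10 + 10)) ℂ (complexBetti A.X 1) := B.reindex τ.symm
  have hB' : ∀ i, B' i = B (τ i) := fun i => by
    change (B.reindex τ.symm) i = _
    rw [Module.Basis.reindex_apply, Equiv.symm_symm]
  have hmemU : ∀ k : Fin 10, B' (Fin.castAdd 10 k) ∈ (Module.End.eigenspace (complexBetti.map ψ.hom.hom.hom 1).hom ((Complex.exp (2 * (Real.pi : ℂ) * Complex.I / 11)) ^ ((((τ (Fin.castAdd 10 k)).1 : Fin 10) : ℕ) + 1))) := by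
    intro k
    rw [hB']
    exact hN.collectedBasis_mem bU _
  have hmemV : ∀ k : Fin 10, B' (Fin.castAdd 10 k) ∈ Module.End.eigenspace (complexBetti.map φ.hom.hom.hom 1).hom s := by
    intro k
    have hj := hτS k
    rw [hS, Finset.mem_filter] at hj
    rw [← hj.2]
    exact eigenspace_le_eigenspace_gval hφ _ (hmemU k)
  -- the wedge of the ten `+`-vectors
  let Bw : Module.Basis (Set.powersetCard (Fin (10 + 10)) 10) ℂ (complexBetti A.X 10) :=
    (B'.exteriorPower 10).map (hΛ.equiv 10)
  let S₀ : Set.powersetCard (Fin (10 + 10)) 10 := Set.powersetCard.ofFinEmbEquiv (Fin.castAddOrderEmb 10)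
  set w : complexBetti A.X (2 * 5) := Bw S₀ with hwdef
  have hw : w = cupPowOne ℂ (ComplexPoints A.X) 10 (fun k => B' (Fin.castAdd 10 k)) := by
    rw [hwdef]
    change hΛ.equiv 10 ((B'.exteriorPower 10) S₀) = _
    rw [exteriorPower.basis_apply, HasExteriorCohomologyH1.equiv_apply, exteriorPower.ιMulti_family,
      wedgeToCup_ιMulti]
    congr 1
    funext k
    simp only [Function.comp_apply, S₀, Equiv.symm_apply_apply]
    rfl
  have hw0 : w ≠ 0 := Bw.ne_zero S₀
  -- `w ∈ E₊`
  have hwW : w ∈ weilClassesPlus A φ 5 11 := by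
    rw [mem_weilClassesPlus_iff]
    intro x y
    rw [hw]
    change singularCohomology.map ℂ ℂ _ 10 (cupPowOne ℂ _ 10 _) = _
    rw [map_cupPowOne]
    have e : (fun i => singularCohomology.map ℂ ℂ
        (AlgPoints.mapContinuous (L := ℂ) (x • 𝟙 A + y • φ).hom.hom.hom) 1 (B' (Fin.castAdd 10 i))) =
        fun i => ((x : ℂ) + (y : ℂ) * s) • B' (Fin.castAdd 10 i) :=
      funext fun i => complexBetti_map_nsmul_id_add_nsmul_one_of_mem_eigenspace (hmemV i) x y
    rw [e, MultilinearMap.map_smul_univ, Finset.prod_const, Finset.card_univ, Fintype.card_fin, hs,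
      ← mul_assoc]
  -- `w` is algebraic
  have hwalg : w ∈ algebraicClasses A.X 5 := by
    rw [hw]
    refine cupPowOne_mem_algebraicClasses_of_pairs 5 (fun k => B' (Fin.castAdd 10 k)) ?_
    intro a
    have hm0 := hmemU ⟨2 * (a : ℕ), by omega⟩
    have hm1 := hmemU ⟨2 * (a : ℕ) + 1, by omega⟩
    rw [← hτpair a] at hm1
    exact hdiv _ _ hm0 _ hm1
  -- conclusion: both Weil lines are spanned by algebraic classes
  have hplus : weilClassesPlus A φ 5 11 ≤ algebraicClasses A.X 5 :=
    (weilClassesPlus_le_span_singleton hΛ hb₁ (by norm_num) hφφ hwW hw0).trans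
      ((Submodule.span_singleton_le_iff_mem _ _).mpr hwalg)
  obtain ⟨w', hw'W, hw'alg, hw'0⟩ :=
    exists_mem_weilClassesMinus_mem_algebraicClasses ⟨w, hwW, hwalg, hw0⟩
  have hminus : weilClassesMinus A φ 5 11 ≤ algebraicClasses A.X 5 :=
    (weilClassesMinus_le_span_singleton hΛ hb₁ (by norm_num) hφφ hw'W hw'0).trans
      ((Submodule.span_singleton_le_iff_mem _ _).mpr hw'alg)
  exact sup_le hplus hminus

end Main

end NormAnchor

/-- **Registered sub-goal `stub_normAnchorWeilClasses` of crux stmt-HodgeConjecture-1262 (line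
`quaternionic-norm-anchors`) — THE ANCHOR THEOREM**: granted `lefschetzOneOne_rational`, on a norm anchor
(`ψ¹¹ = 𝟙`, `Σψᵏ = 0`, `φ = g(ψ)`, typed `L`-signature `(1,1)⁵`) the whole `ℚ(√-11)`-Weil plane
`weilClassesOf A φ 5 11` consists of algebraic classes (`NormAnchor.weilClassesOf_le_algebraicClasses_of_normAnchor`).
[cite: vanGeemen1994HodgeAV, proof of Thm. 6.12] [cite: MoonenZarhin1998WeilClasses, §2–§5] -/
theorem stub_normAnchorWeilClasses : lefschetzOneOne_rational → ∀ (A : AbelianVariety ℂ) (ψ φ : A ⟶ A), A.dim = 10 → (CategoryTheory.End.of ψ) ^ 11 = 1 → (Finset.range 11).sum (fun k => (CategoryTheory.End.of ψ) ^ k) = 0 → (CategoryTheory.End.of φ) = (CategoryTheory.End.of ψ) + (CategoryTheory.End.of ψ) ^ 3 + (CategoryTheory.End.of ψ) ^ 4 + (CategoryTheory.End.of ψ) ^ 5 + (CategoryTheory.End.of ψ) ^ 9 - (CategoryTheory.End.of ψ) ^ 2 - (CategoryTheory.End.of ψ) ^ 6 - (CategoryTheory.End.of ψ) ^ 7 -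 (CategoryTheory.End.of ψ) ^ 8 - (CategoryTheory.End.of ψ) ^ 10 → (∀ u : ℂ, u ^ 11 = 1 → u ≠ 1 → Module.End.eigenspace (complexBetti.map (𝟙 A + ψ).hom.hom.hom 2).hom ((1 + u) ^ 2) ≤ Submodule.span ℂ {b : complexBetti A.X 2 | IsRationalClass b ∧ IsOfHodgeType 10 A.X 2 1 1 b}) → weilClassesOf A φ 5 11 ≤ algebraicClasses A.X 5 :=
  fun hL _ _ _ hA h11 hnorm hφ hsig =>
    NormAnchor.weilClassesOf_le_algebraicClasses_of_normAnchor hL hA h11 hnorm hφ hsig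

end Summit.HodgeConjecture.HodgeConjecture.Theorems.HeckePrymWeil

end
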